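import Summits.CriticalPhenomena.SAWScalingLimit.Theses.SAWDefectDecoherence
import Summits.CriticalPhenomena.SAWScalingLimit.Theses.SAWPhaseRetrieval
import Summits.CriticalPhenomena.SAWScalingLimit.Theses.SAWWindingAlias
import Summits.CriticalPhenomena.SAWScalingLimit.Theses.SAWDevelopingMap
import Summits.CriticalPhenomena.SAWScalingLimit.Theses.SAWCompassLattice
import Summits.CriticalPhenomena.SAWScalingLimit.Theses.SAWResidueField
import Summits.CriticalPhenomena.SAWScalingLimit.Theorems.SAWDevelopingMapHexTransferLineReduction
import Summits.CriticalPhenomena.SAWScalingLimit.Theorems.HexConjecture.Negative.NonVacuity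
import Literature.Probability.RandomPlanarGeometry.SLEUniquenessInLaw
import Literature.Probability.RandomPlanarGeometry.SelfAvoidingWalkProofs
import Literature.Probability.RandomPlanarGeometry.SAWScalingLimitFamily

/-!
# Disproof of `HexTransfer` (crux stmt-CriticalPhenomena-14221) — standing disprover's work file
(cdisprove, refuter-cdisprove-stmt-CriticalPhenomena-14221-0, cycle 1, 2026-08-16; published at
`Cruxes/HexTransfer/Disproof.lean`; the landable part LANDED as
`Theorems/HexTransfer/Negative/RefutationCost.lean`, p95732 ACCEPTED, commit d9ea020e22de — importable as
`Summits.CriticalPhenomena.SAWScalingLimit.Theorems.HexTransfer.Negative.RefutationCost`, namespace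
`…Cruxes.HexTransfer.Negative`; this work file keeps self-contained copies under `…Disproof`).

The crux (identical bodies in `Theses.SAWDefectDecoherence / .SAWPhaseRetrieval / .SAWWindingAlias /
.SAWDevelopingMap`, all `Iff.rfl` with `HexSAWScalingLimit → _root_.SAWScalingLimit`):

  `HexTransfer := (∀ D a b, IsEmbEndpointApprox hexGraph hexCenter D a b →
      ConvergesInLawToSLE (8/3) D (fun δ γ ↦ γ.curve) (fun δ ↦ hexSAWLaw D.carrier δ (a δ) (b δ)))
      → SAWScalingLimit`

= "Duminil-Copin–Smirnov 2012 Conjecture 1 (critical hexagonal SAW ⇒ chordal SLE(8/3), as formalised)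
IMPLIES the δℤ² sub-problem statement" — lattice universality in implicational form.

## VERDICT (cycle 1): RESISTS — and resists STRUCTURALLY, not for want of attacks. Findings:

§1 REFUTATION COST (kernel-checked below; LANDED in `Negative/RefutationCost.lean`, p95732).
   `¬ HexTransfer ↔ HexSAWScalingLimit ∧ ¬ SAWScalingLimit`. Any refutation must (i) PROVE DCS Conjecture 1
   (open since 2004/2012; the tree registers it `@[conjecture]`, crux stmt-0808 resists its own disprover,
   see `Cruxes/HexConjecture/Disproof.lean`) and (ii) DISPROVE the audited summit conjunct. More generally
   `¬ (P → SAWScalingLimit) → ¬ SAWScalingLimit` for every `P`: no implication-shaped tail crux of the cone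
   is refutable short of refuting the summit conjunct, and every junk asymmetry between the hexagonal and
   the square definitions is harmless to the crux unless it makes the ANTECEDENT provable (none does: §3).
§2 LOAD-BEARING ANALYSIS is degenerate for this crux: it has ONE hypothesis, the antecedent A; dropping it
   leaves `SAWScalingLimit` (the summit conjunct — not refutable by a refuter); weakening A to anything
   provable A₀ leaves `A₀ → S ↔ S`; weakening it to anything open leaves an irrefutable implication. So no
   `_false_without_` theorem can exist for `HexTransfer` unless the summit conjunct is false
   (`HexTransferWithoutAntecedent`, `not_false_without_antecedent_unless_summit_false`).
§3 JUNK AUDIT of the antecedent (could A be PROVABLE for a silly reason, making the crux ↔ S, or REFUTABLE,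
   making the crux trivially true?). Independent re-read of the six definition pairs
   (`law`/`embLaw`, `weight`/`embWeight` (x^{#steps} vs x^{#vertices}: cancels in the normalisation),
   `meshDomain`/`embMeshDomain` (largest component(s) by `ncard`, union if tied, both sides),
   `discreteDomainGraph`/`embDomainGraph` (`embMeshGraph_zd`), `IsEndpointApprox`/`IsEmbEndpointApprox`
   (same three clauses), `DomainSAW.curve`/`EmbDomainSAW.curve` (polyline through rescaled vertices)):
   no asymmetry. A is neither junk-true (under `IsEmbEndpointApprox` the hexagonal law is eventually a
   probability measure on a finite non-empty SAW space and `TendstoLaw` to an `IsSLECurve` is a genuine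
   statement; `ConvergesInLawToSLE` is `∃ Γ, IsSLECurve … ∧ …`, so an uninhabited SLE side would make A
   FALSE, i.e. the crux TRUE) nor junk-false (the sibling disprover's three `_false_without_` witnesses all
   need a clause of `IsEmbEndpointApprox` dropped: `HexConjecture.Negative.LoadBearing`). Agrees with the
   two crux-attack refuters (03:34Z, 03:52Z) and three grounders.
§4 RIGIDITY UNDER THE ANTECEDENT (new; kernel-checked below, LANDED in `Negative/RefutationCost.lean`, p95732).
   The route docstrings sell the implicational form as "weaker than the asymptotic equality of laws
   LatticeUniversality (stmt-0807): it may use existence and conformal invariance of the hexagonal limit".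
   At the level of statements this buys NOTHING: if A holds then `HexTransfer → LatticeUniversality` for
   EVERY pairing of endpoint approximations (both limits are chordal SLE(8/3) random curves in the same
   Dobrushin domain, equal in law by `IsSLECurve.map_eq_holds`, PROVED in the tree), and with the routine
   `HexEndpointApproxExists` (stmt-9864) `HexTransfer ↔ LatticeUniversality`; if A fails the crux is
   vacuous. Informative for provers: there is no "cheap implicational" proof that avoids proving full
   lattice universality of the chordal law (given A), and conversely a proof of LatticeUniversality +
   stmt-9864 closes the crux in three lines (`hexTransfer_of_latticeUniversality`, the two-ε argument, here).
§5 NO MESH-WISE IDENTIFICATION: `x_c(ℤ²) ≤ 1/2 < 1/√(2+√2) = x_c(ℍ)` (`criticalFugacity_lt_hexCriticalFugacity`,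
   from the tree's proved `2 ≤ μ(ℤ²)`): the two critical Gibbs weights are powers of different numbers, so
   every transfer is asymptotic; ideas that re-embed square walks as hexagonal walks "with the same weight"
   change the fugacity class (supercritical resp. subcritical on the other lattice).
§6 LINE `Sketch` (lead prover-line-stmt-CriticalPhenomena-14221-0; skeleton `Cruxes/HexTransfer/Lines/Sketch.lean`,
   composition `HexTransfer_of := stub_lineReduction stub_thetaTransport stub_surfaceUniversality`, p93700):
   * JOINT SUFFICIENCY is kernel-checked (p93700) — nothing smuggled.
   * `stub_thetaTransport : HexConjecture → YBSquareSLE`: `¬ stub ↔ HexSAWScalingLimit ∧ ¬ YBSquareSLE`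
     — irrefutable for the same structural reason as the crux; under A it IS `YBSquareSLE` (crux stmt-6967).
     `YBSquareSLE` is not junk-refutable: `IsYBEndpointApprox.nonempty` + all five GM local weights at
     Θ ≡ π/2 positive (`Compass.weights_pi_div_two_mem_Ioo`, p89754) + finitely many walks in a bounded
     domain ⇒ `ybLaw` is eventually a probability measure; non-vacuous by `stub_compassEndpoints` (p90649).
   * The hexagonal hypothesis is consumed ONLY there, and `sawScalingLimit_of_ybSquareSLE_of_surfaceUniversality`
     (p93700) proves the SUMMIT CONJUNCT from `YBSquareSLE ∧ SurfaceUniversality` with A discarded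
     (`line_discards_antecedent` below): as typed, the line is a proof of S through route SAWCompassLattice's
     two cruxes, with `HexConjecture → YBSquareSLE` (= T1 bookkeeping + T2 law-level Yang–Baxter transport,
     lead's analysis in `Lines/Sketch.md`) as the only place the hexagonal lattice enters.
   * Natural strengthening of T2 that IS false: EXACT finite-volume Θ-invariance of the Yang–Baxter law
     (ideator-1's exact slit check, `Cruxes/HexTransfer/EVIDENCE-ideator1-ybfold.md` §C: across-slit column
     exchange moves an avoidance probability by ≈ 7.6e-3, stable in the strip height; reproduced and extended
     by triager r1-1, `TRIAGE-r1-1.md`). Not re-typed in Lean here (GM weights are trigonometric-algebraic;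
     an exact `norm_num` certificate is possible but buys nothing the two enumerations do not already show).
   * `stub_surfaceUniversality = SAWCompassLattice.SurfaceUniversality` (stmt-6964) verbatim: an
     unconditional asymptotic equality of two honest SAW laws; non-vacuous (p90177); refutable only by
     knowing both scaling limits — open, no junk handle (both laws eventually probability measures).
§7 DISPROVER-WANTED (lead, `Lines/Sketch.md`): "Θ-dependence of GM-walk left-passage/strip observables
   π/3 vs π/2 (would falsify YBSquareSLE 6967)". Assessment: finite-size Θ-dependence is CERTAIN (§6, slit
   check) and says nothing about `YBSquareSLE`, a statement about the δ → 0 limit; a meaningful test needs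
   left-passage probabilities extrapolated in the system size against Schramm's κ = 8/3 formula, i.e. a
   transfer-matrix / Monte-Carlo study of the GM walk at Θ ≡ π/2 — evidence at best, never a Lean kill, and
   the published Monte-Carlo tests of SLE(8/3) predictions for lattice SAW (Kennedy 2002/2004; not re-read
   this session, `lit` search degraded) support universality rather than threaten it. Not run this cycle
   (compute discipline: no certificate could come out of it). If the lead still wants the number, the right
   job is ONE `kit compute` transfer-matrix run of Schramm's left-passage profile in strips of widths 4–10
   at Θ ≡ π/2 with GM weights vs the same for the honeycomb walk, both compared to
   `P(left of z) = 1/2 + (Γ(2/3)/(√π Γ(1/6))) ₂F₁(1/2, 2/3; 3/2; −cot²θ) cot θ` at κ = 8/3.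
§8 HAZARD for importers (found while writing §1): `Theses.SAWDefectDecoherence.HexConjecture` was DROPPED
   from that route file at rev 17 (2026-08-16T03:09Z) but is still referenced by landed files
   (`Theorems/HexConjecture/Negative/NonVacuity.lean`, `…/BoundaryWitness.lean`,
   `Theorems/ObservableToSLER/Negative/RootPinNecessity.lean`, `Cruxes/ObservableToSLER/Disproof.lean`,
   `Cruxes/HexConjecture/Lines/root-locality-replaces-loewner.lean`): their oleans on the farm are stale —
   `#check` shows the old type but any USE of e.g. `NonVacuity.exists_isSLECurve_of_hexConjecture` fails
   with `Unknown constant …SAWDefectDecoherence.HexConjecture`, and those files will not rebuild. State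
   hexagonal hypotheses as `HexSAWScalingLimit` / `SAWDevelopingMap.HexConjecture` (live) instead.

## Census of attacks (cycle 1)
tried: elaboration of all four copies (rc 0) · logical skeleton (§1) · load-bearing mutation (§2, degenerate
by shape) · junk audit of six definition pairs + SLE side (§3, no handle) · rigidity/strength analysis vs
LatticeUniversality (§4, PROVED) · finite-volume identification (§5, REFUTED: fugacity gap) · line stubs:
refutability, vacuity, joint sufficiency, antecedent usage (§6) · disprover-wanted computation triaged (§7).
NOT tried (and why): `kit compute` Θ-scan (§7: cannot yield a certificate); concrete-domain refutation of
"mesh-wise equality of pushed-forward laws" (true but needs a 400-line explicit-geometry file for a straw man).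
-/

noncomputable section

namespace Summit.CriticalPhenomena.SAWScalingLimit.Cruxes.HexTransfer.Disproof

open MeasureTheory Filter Topology
open Literature.Probability.LatticeModels Literature.Probability.RandomPlanarGeometry
open Literature.Probability.RandomPlanarGeometry.SAW
open Summit.CriticalPhenomena.SAWScalingLimit.Theses
open scoped NNReal ENNReal BoundedContinuousFunction

/-! ## §0 One statement (four route copies, Literature antecedent) -/

/-- The crux is `HexSAWScalingLimit → SAWScalingLimit`. [folklore] -/
theorem hexTransfer_iff :
    SAWDefectDecoherence.HexTransfer ↔ (HexSAWScalingLimit → _root_.SAWScalingLimit) := Iff.rfl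

/-- All four route copies are syntactically one statement. [folklore] -/
theorem copies_agree :
    (SAWDefectDecoherence.HexTransfer ↔ SAWPhaseRetrieval.HexTransfer) ∧
    (SAWDefectDecoherence.HexTransfer ↔ SAWWindingAlias.HexTransfer) ∧
    (SAWDefectDecoherence.HexTransfer ↔ SAWDevelopingMap.HexTransfer) :=
  ⟨Iff.rfl, Iff.rfl, Iff.rfl⟩

/-- The antecedent is the live sibling crux `SAWDevelopingMap.HexConjecture` (stmt-0808). [folklore] -/
theorem antecedent_is_hexConjecture : SAWDevelopingMap.HexConjecture ↔ HexSAWScalingLimit := Iff.rfl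

/-! ## §1 Refutation cost -/

/-- `¬ HexTransfer` = DCS Conjecture 1 ∧ ¬(summit conjunct). [folklore] -/
theorem not_hexTransfer_iff :
    ¬ SAWDefectDecoherence.HexTransfer ↔ (HexSAWScalingLimit ∧ ¬ _root_.SAWScalingLimit) :=
  Classical.not_imp

/-- The summit conjunct implies the crux (so the crux is at most as hard as the summit). [folklore] -/
theorem hexTransfer_of_target (hS : _root_.SAWScalingLimit) : SAWDefectDecoherence.HexTransfer :=
  fun _ => hS

/-- A failure of DCS Conjecture 1 would make the crux vacuously true. [folklore] -/
theorem hexTransfer_of_not_antecedent (hA : ¬ HexSAWScalingLimit) : SAWDefectDecoherence.HexTransfer :=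
  fun h => (hA h).elim

/-- Under the antecedent the crux IS the summit conjunct. [folklore] -/
theorem hexTransfer_iff_target_of_antecedent (hA : HexSAWScalingLimit) :
    SAWDefectDecoherence.HexTransfer ↔ _root_.SAWScalingLimit :=
  ⟨fun h => h hA, fun hS _ => hS⟩

/-- No implication INTO the summit conjunct is refutable short of refuting the summit conjunct. [folklore] -/
theorem not_target_of_not_imp_target {P : Prop} (h : ¬ (P → _root_.SAWScalingLimit)) :
    ¬ _root_.SAWScalingLimit :=
  fun hS => h fun _ => hS

/-- Existence debt of a refutation: a chordal SLE(8/3) random curve in the unit disc. [folklore] -/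
theorem exists_isSLECurve_unitDisc_of_not_hexTransfer (h : ¬ SAWDefectDecoherence.HexTransfer) :
    ∃ Γ, IsSLECurve ((8 : ℝ≥0) / 3) DobrushinDomain.unitDisc Γ := by
  obtain ⟨Γ, hΓ, -, -⟩ :=
    (not_hexTransfer_iff.1 h).1 _ _ _ HexConjecture.NonVacuity.isEmbEndpointApprox_unitDisc
  exact ⟨Γ, hΓ⟩

/-! ## §2 Load-bearing analysis (degenerate by shape) -/

/-- The crux with its only hypothesis dropped: the summit conjunct itself. [folklore] -/
def HexTransferWithoutAntecedent : Prop := _root_.SAWScalingLimit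

/-- Unfolding. [folklore] -/
theorem withoutAntecedent_iff : HexTransferWithoutAntecedent ↔ _root_.SAWScalingLimit := Iff.rfl

/-- There is no `hexTransfer_false_without_antecedent` unless the summit conjunct is false — and then the
crux itself is decided by the antecedent alone. [folklore] -/
theorem not_false_without_antecedent_unless_summit_false :
    ¬ HexTransferWithoutAntecedent → (SAWDefectDecoherence.HexTransfer ↔ ¬ HexSAWScalingLimit) :=
  fun hS => ⟨fun h hA => hS (h hA), fun hA h => (hA h).elim⟩

/-! ## §4 Rigidity under the antecedent -/

/-- Two families converging in law along the mesh filter to random elements with the same law have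
asymptotically equal integrals against every bounded continuous test function. [folklore] -/
theorem tendsto_sub_of_tendstoLaw {Ω₁ Ω₂ : ℝ → Type*} [∀ δ, MeasurableSpace (Ω₁ δ)]
    [∀ δ, MeasurableSpace (Ω₂ δ)] {Ω' : Type*} [MeasurableSpace Ω'] {X : Type*} [TopologicalSpace X]
    [MeasurableSpace X] [OpensMeasurableSpace X]
    {Y₁ : ∀ δ, Ω₁ δ → X} {P₁ : ∀ δ, Measure (Ω₁ δ)} {Y₂ : ∀ δ, Ω₂ δ → X} {P₂ : ∀ δ, Measure (Ω₂ δ)}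
    {Z₁ Z₂ : Ω' → X} {W : Measure Ω'} (h₁ : TendstoLaw Y₁ P₁ Z₁ W) (h₂ : TendstoLaw Y₂ P₂ Z₂ W)
    (hZ₁ : AEMeasurable Z₁ W) (hZ₂ : AEMeasurable Z₂ W) (hlaw : W.map Z₁ = W.map Z₂) (f : X →ᵇ ℝ) :
    Tendsto (fun δ => (∫ ω, f (Y₁ δ ω) ∂P₁ δ) - ∫ ω, f (Y₂ δ ω) ∂P₂ δ) (𝓝[>] (0 : ℝ)) (𝓝 0) := by
  have hint : ∫ ω, f (Z₁ ω) ∂W = ∫ ω, f (Z₂ ω) ∂W := by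
    rw [← integral_map hZ₁ f.continuous.aestronglyMeasurable,
      ← integral_map hZ₂ f.continuous.aestronglyMeasurable, hlaw]
  have h := (h₁ f).sub (h₂ f)
  rwa [hint, sub_self] at h

/-- **Rigidity**: given DCS Conjecture 1, `HexTransfer` forces `LatticeUniversality` (stmt-0807) for every
pairing of endpoint approximations — negatively: `A → ¬ LatticeUniversality → ¬ HexTransfer`. [folklore] -/
theorem not_hexTransfer_of_not_latticeUniversality (hA : HexSAWScalingLimit)
    (hU : ¬ SAWResidueField.LatticeUniversality) : ¬ SAWDefectDecoherence.HexTransfer := by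
  intro hTr
  apply hU
  intro D a b a' b' hab hab' f
  obtain ⟨Γ, hΓ, -, hT⟩ := hTr hA D a b hab
  obtain ⟨Γ', hΓ', -, hT'⟩ := hA D a' b' hab'
  exact tendsto_sub_of_tendstoLaw hT hT' hΓ.1 hΓ'.1 (IsSLECurve.map_eq_holds hΓ hΓ') f

/-- The two-ε argument (positive direction; work-file only, a prover lands it): hexagonal endpoint
approximations + lattice universality give the crux. [folklore] -/
theorem hexTransfer_of_latticeUniversality (hE : SAWResidueField.HexEndpointApproxExists)
    (hU : SAWResidueField.LatticeUniversality) : SAWDefectDecoherence.HexTransfer := by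
  intro hA D a b hab
  obtain ⟨a', b', hab'⟩ := hE D a b hab
  obtain ⟨Γ, hΓ, -, hT⟩ := hA D a' b' hab'
  refine ⟨Γ, hΓ, Eventually.of_forall fun δ => aemeasurable_curve D.carrier δ (a δ) (b δ), fun f => ?_⟩
  have h := (hU D a b a' b' hab hab' f).add (hT f)
  rw [zero_add] at h
  exact h.congr fun δ => sub_add_cancel _ _

/-- Hence, where the crux has content (antecedent true) and modulo the routine stmt-9864, it is EQUIVALENT
to lattice universality of the chordal law — not weaker. [folklore] -/
theorem hexTransfer_iff_latticeUniversality (hA : HexSAWScalingLimit)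
    (hE : SAWResidueField.HexEndpointApproxExists) :
    SAWDefectDecoherence.HexTransfer ↔ SAWResidueField.LatticeUniversality :=
  ⟨fun h => Classical.byContradiction fun hU => not_hexTransfer_of_not_latticeUniversality hA hU h,
    hexTransfer_of_latticeUniversality hE⟩

/-! ## §5 The two critical weights are different numbers (refuted mesh-wise identification) -/

/-- `x_c(ℤ²) < x_c(ℍ)`. [cite: MadrasSlade1993, §1.2, eq. (1.2.2)] -/
theorem criticalFugacity_lt_hexCriticalFugacity : criticalFugacity < hexCriticalFugacity := by
  have h1 : criticalFugacity ≤ 1 / 2 := criticalFugacity_le_half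
  have hs2 : Real.sqrt 2 < 2 := (Real.sqrt_lt' (by norm_num)).2 (by norm_num)
  have h2 : Real.sqrt (2 + Real.sqrt 2) < 2 := (Real.sqrt_lt' (by norm_num)).2 (by linarith)
  have h3 : (1 : ℝ) / 2 < hexCriticalFugacity := by
    rw [hexCriticalFugacity, one_div, inv_lt_inv₀ (by norm_num) (by positivity)]
    exact h2
  exact lt_of_le_of_lt h1 h3

/-- The natural strengthening "the two critical laws give equal weight to walks of equal length" is false
at every positive length. [folklore] -/
theorem not_equalWeights : ¬ ∀ n : ℕ, criticalFugacity ^ n = hexCriticalFugacity ^ n := fun h =>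
  (pow_lt_pow_left₀ criticalFugacity_lt_hexCriticalFugacity criticalFugacity_pos_lt_one'.1.le
    one_ne_zero).ne (h 1)

/-! ## §6 Line `Sketch` -/

/-- Refutation cost of the lead's stub. [folklore] -/
theorem not_thetaTransport_iff :
    ¬ (SAWDevelopingMap.HexConjecture → SAWCompassLattice.YBSquareSLE) ↔
      (HexSAWScalingLimit ∧ ¬ SAWCompassLattice.YBSquareSLE) :=
  Classical.not_imp

/-- Under the antecedent the stub is crux stmt-6967 itself. [folklore] -/
theorem thetaTransport_iff_of_antecedent (hA : HexSAWScalingLimit) :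
    (SAWDevelopingMap.HexConjecture → SAWCompassLattice.YBSquareSLE) ↔ SAWCompassLattice.YBSquareSLE :=
  ⟨fun h => h hA, fun hY _ => hY⟩

/-- The line discards the antecedent: with `YBSquareSLE` from any source, the landed reduction p93700 proves
the summit conjunct (and the crux a fortiori) without the hexagonal lattice. [folklore] -/
theorem line_discards_antecedent (hY : SAWCompassLattice.YBSquareSLE)
    (hU : SAWCompassLattice.SurfaceUniversality) : SAWDevelopingMap.HexTransfer :=
  Sketch.stub_lineReduction (fun _ => hY) hU

/-- `YBSquareSLE` is non-vacuous and has an existence debt of its own: it constructs a chordal SLE(8/3)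
random curve in EVERY Dobrushin domain (port endpoint approximations exist by the landed
`stub_compassEndpoints`, p90649). [folklore] -/
theorem exists_isSLECurve_of_ybSquareSLE (hY : SAWCompassLattice.YBSquareSLE) (D : DobrushinDomain) :
    ∃ Γ, IsSLECurve ((8 : ℝ≥0) / 3) D Γ := by
  obtain ⟨a, b, hab⟩ := Sketch.stub_compassEndpoints D
  obtain ⟨Γ, hΓ, -, -⟩ := hY D a b hab
  exact ⟨Γ, hΓ⟩

/-- … whereas the crux's antecedent only pays that debt on domains known to carry a hexagonal endpoint
approximation (every domain, once stmt-9864 lands; the δℤ² twin `exists_isEndpointApprox` is proved, so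
the summit conjunct pays it everywhere). [folklore] -/
theorem exists_isSLECurve_of_target (hS : _root_.SAWScalingLimit) (D : DobrushinDomain) :
    ∃ Γ, IsSLECurve ((8 : ℝ≥0) / 3) D Γ := by
  obtain ⟨a, b, hab⟩ := exists_isEndpointApprox D
  obtain ⟨Γ, hΓ, -, -⟩ := hS D a b hab
  exact ⟨Γ, hΓ⟩

end Summit.CriticalPhenomena.SAWScalingLimit.Cruxes.HexTransfer.Disproof
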